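import Summits.HodgeConjecture.HodgeConjecture.Theorems.Q8SymplecticPowersGenericityPolynomials
import Literature.AlgebraicGeometry.HodgeTheory.QuaternionicQuarticDeckChartBirational
import Literature.AlgebraicGeometry.HodgeTheory.BettiOneBirationalInvariance
import Literature.AlgebraicGeometry.Motives.FermatHypersurface
import HarnessLib

/-!
# Route `Q8SymplecticPowers`, crux K1Q (stmt-HodgeConjecture-24190), line `mechanism-v2`: stub S1 `stub_regularVeryGeneralQ`
# REDUCED TO ONE REGULAR SMOOTH MODEL PER GENERIC MEMBER — NO FAMILY, NO DECK PAIR, NO KOLLÁR BINDER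

Helper file (`--supports stmt-HodgeConjecture-24190 --as helper`; nothing here closes an item). Sorry-free; axioms standard; no
definition; no named fact.

The registered stub S1 says: for every even `e ≥ 4` there are countably many polynomials `G i` in the coefficients of `(c, ψ)`, each
non-vanishing at some admissible pair, such that for every admissible `(c, ψ)` off all their zero sets EVERY smooth projective
surface `X` birational over `ℂ` to ANY scheme `V` cut out in `ℙ³` by the quaternionic quartic form
`x₃⁴ x₂^{2e} − c (σc)³ ((x₀ − x₁) ψ)²` has `b₁(X) = 0`. The tree reductions so far (`Q8SymplecticPowersRegularOfOneFibre`, Bx g20;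
`Q8SymplecticPowersRegularOfFamilyOneFibre`, this seat) route S1 through a smooth projective FAMILY of models and Ehresmann. None is
needed. Since

* `b₁` is a birational invariant of smooth projective surfaces (`BettiUniverse.finrank_bettiCohomology_one_eq_of_birationalOver`),
* two reduced `ℂ`-schemes cut out by the same form are `ℂ`-isomorphic (`IsHypersurfaceCutOutBy.nonempty_iso`, Hartshorne II Ex. 3.11 (d)),
* and the line's genericity polynomials (G7 `Q8SymplecticPowersGenericityPolynomials.exists_genericityPolynomials`, run on the WHOLE
  parameter space `W = ⊤` with no bad set) convert «off the zero set of ONE non-zero coefficient polynomial `g`» into the registered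
  `∃ G : ℕ → …` device (non-vacuity included, through the coset sweep `(c, ψ) ↦ a ↦ (cOf a, ψOf a)`),

S1 follows from the plain statement

> **(R)** for every even `e ≥ 4` there is `0 ≠ g ∈ ℂ[a_i | i ∈ CIdx e]` such that for every coefficient vector `a` with `g(a) ≠ 0`
> SOME smooth projective surface `X₀`, birational over `ℂ` to SOME scheme `V₀` cut out by the quartic form of `(cOf a, ψOf a)`, has
> `finrank_ℚ H¹(X₀(ℂ); ℚ) = 0`

— `stub_regularVeryGeneralQ_of_generic_regularModel`. (R) is the honest residue of S1 and it is a statement IN PRINT about ONE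
surface per parameter: the irregularity of (any desingularisation of) the cyclic quartic plane `w⁴ = c·(σc)³·(x₀−x₁)²·ψ²` vanishes for
`(c, ψ)` general — D. Naie, *The irregularity of cyclic multiple planes after Zariski*, Enseign. Math. 53 (2007), Thm. 1.1 (after
Zariski 1931 and Esnault–Viehweg 1982); its discharge needs that fact as a Literature named fact plus a smooth model (the tree's PROVED
projective Hironaka `Resolution.exists_isResolution_isProjectiveOver_of_isProjectiveOver`, or the fibre of the Kollár-free family
`Q8Family.qFamily_holds`).

* `nonempty_complexPoints_base_top` — the whole parameter space has a complex point (the origin), so that G7 applies with `W = ⊤`.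
* `stub_regularVeryGeneralQ_of_generic_regularModel` — (R) → S1 VERBATIM.

Honest scope: a reduction; S1, K1Q, HC are NOT proved here.
-/

set_option linter.dupNamespace false

noncomputable section

open CategoryTheory AlgebraicGeometry
open Literature.AlgebraicGeometry Literature.AlgebraicGeometry.Motives Literature.AlgebraicGeometry.HodgeTheory
open Literature.AlgebraicGeometry.HodgeTheory.BettiUniverse Literature.AlgebraicGeometry.HodgeTheory.Q8Family

namespace Summit.HodgeConjecture.HodgeConjecture.Theorems.Q8SymplecticPowersRegularOfGenericRegularModel

/-- **The parameter space `𝔸^{CIdx e}` has a complex point** (the origin `a = 0`, as a morphism `Spec ℂ → ⊤ ⊆ Spec ℂ[a]` over `ℂ`).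
[cite: Hartshorne1977, II Ex. 2.7] -/
theorem nonempty_complexPoints_base_top (e : ℕ) :
    Nonempty (ComplexPoints (base (⊤ : (Spec (.of (ParamRing e))).Opens))) := by
  let W : (Spec (.of (ParamRing e))).Opens := ⊤
  let a : CIdx e → ℂ := fun _ => 0
  let g₀ : Spec (.of ℂ) ⟶ Spec (.of (ParamRing e)) := Spec.map (CommRingCat.ofHom (MvPolynomial.eval a))
  have hg₀ : Set.range g₀ ⊆ Set.range W.ι := by
    rintro _ ⟨x, rfl⟩
    rw [Scheme.Opens.range_ι]
    trivial
  obtain ⟨s₀, hs₀⟩ : ∃ s₀ : Spec (.of ℂ) ⟶ (W : Scheme), s₀ ≫ W.ι = g₀ := ⟨_, IsOpenImmersion.lift_fac W.ι g₀ hg₀⟩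
  have hc : (MvPolynomial.eval a).comp (algebraMap ℂ (MvPolynomial (CIdx e) ℂ)) = algebraMap ℂ ℂ :=
    RingHom.ext fun r => by simp [MvPolynomial.algebraMap_eq]
  refine ⟨AlgPoints.mk (X := base W) s₀ ?_⟩
  calc s₀ ≫ (base W).hom
      = (s₀ ≫ W.ι) ≫ Spec.map (CommRingCat.ofHom (algebraMap ℂ (MvPolynomial (CIdx e) ℂ))) := (Category.assoc _ _ _).symm
    _ = Spec.map (CommRingCat.ofHom (algebraMap ℂ ℂ)) := by rw [hs₀, ← Spec.map_comp, ← CommRingCat.ofHom_comp, hc]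

/-- **S1 from ONE regular smooth model per general member (no family, no deck pair, no Kollár binder).** If for every even `e ≥ 4`
there is a non-zero coefficient polynomial `g` such that for every coefficient vector `a` with `g(a) ≠ 0` some smooth projective surface
`X₀`, birational over `ℂ` to some scheme `V₀` cut out in `ℙ³` by the quaternionic quartic form of `(cOf a, ψOf a)`, has `b₁(X₀) = 0`,
then the registered statement of S1 holds: very generally every smooth projective `X` birational over `ℂ` to `V_(c,ψ)` has
`b₁(X) = 0` (module docstring: birational invariance of `b₁`, uniqueness of the reduced hypersurface, genericity polynomials on
`W = ⊤`). [cite: Hartshorne1977, II Ex. 3.11 (d), II Ex. 8.8 and V Remark 5.6.1] [cite: VoisinHodgeI2002, §9.1.1 Thm. 9.3] -/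
theorem stub_regularVeryGeneralQ_of_generic_regularModel
    (HR : ∀ ⦃e : ℕ⦄, Even e → 4 ≤ e → ∃ g : ParamRing e, g ≠ 0 ∧ ∀ a : CIdx e → ℂ, MvPolynomial.eval a g ≠ 0 →
      ∃ (X₀ V₀ : SchemeOver ℂ) (_ : IsSmoothProjective 2 X₀), IsHypersurfaceCutOutBy 3 (quarticForm e (cOf a) (ψOf a)) V₀ ∧
        AlgebraicGeometry.Scheme.BirationalOver X₀.hom V₀.hom ∧ Module.finrank ℚ (bettiCohomology X₀ 1) = 0) :
open Literature.AlgebraicGeometry.Motives Literature.AlgebraicGeometry.HodgeTheory Literature.AlgebraicGeometry.HodgeTheory.BettiUniverse CategoryTheory.Limits in ∀ ⦃e : ℕ⦄, Even e → 4 ≤ e → ∃ G : ℕ → MvPolynomial ({d : Fin 3 →₀ ℕ // d.degree = 1} ⊕ {d : Fin 3 →₀ ℕ // d.degree = e - 1}) ℂ, (∀ i, ∃ c ψ : MvPolynomial (Fin 3) ℂ, c.IsHomogeneous 1 ∧ ψ.IsHomogeneous (e - 1) ∧ MvPolynomial.rename (Equiv.swap (0 : Fin 3) 1) ψ = ψ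 ∧ MvPolynomial.eval (Sum.elim (fun d => c.coeff d.1) (fun d => ψ.coeff d.1)) (G i) ≠ 0) ∧ ∀ c ψ : MvPolynomial (Fin 3) ℂ, c.IsHomogeneous 1 → ψ.IsHomogeneous (e - 1) → MvPolynomial.rename (Equiv.swap (0 : Fin 3) 1) ψ = ψ → (∀ i, MvPolynomial.eval (Sum.elim (fun d => c.coeff d.1) (fun d => ψ.coeff d.1)) (G i) ≠ 0) → ∀ ⦃V X : SchemeOver ℂ⦄ (hX : IsSmoothProjective 2 X), IsHypersurfaceCutOutBy 3 (MvPolynomial.X (Fin.last 3) ^ 4 * MvPolynomial.X (Fin.castSucc 2) ^ (2 * e) - MvPolynomial.rename Fin.castSucc (c * MvPolynomial.rename (Equiv.swap (0 : Fin 3) 1) c ^ 3 * ((MvPolynomial.X 0 - MvPolynomial.X 1) * ψ) ^ 2)) V → AlgebraicGeometry.Scheme.BirationalOver X.hom V.hom → Module.finrank ℚ (bettiCohomology X 1) = 0 := by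
  intro e he h4
  obtain ⟨g, hg, hR⟩ := HR he h4
  -- the genericity polynomials on the whole parameter space, with no bad set and `g₀ := g`
  let W : (Spec (.of (ParamRing e))).Opens := ⊤
  have hne : Nonempty (ComplexPoints (base W)) := nonempty_complexPoints_base_top e
  have hBad : ∀ j : ℕ, IsZariskiClosedOnPoints (base W) ((fun _ : ℕ => (∅ : Set (ComplexPoints (base W)))) j) ∧
      (fun _ : ℕ => (∅ : Set (ComplexPoints (base W)))) j ≠ Set.univ := by
    intro j'
    refine ⟨⟨∅, isClosed_empty, by ext P; simp⟩, ?_⟩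
    obtain ⟨t₀⟩ := hne
    intro h
    have ht₀ : t₀ ∈ (Set.univ : Set (ComplexPoints (base W))) := Set.mem_univ _
    rw [← h] at ht₀
    exact ht₀
  obtain ⟨G, hGne, hGpt⟩ := Q8SymplecticPowersGenericityPolynomials.exists_genericityPolynomials W hne (fun _ => ∅) hBad g hg
  refine ⟨G, hGne, ?_⟩
  intro c ψ hc hψ hψσ hGi V X hX hV hbirX
  -- a parameter point `a = a(t)` over `(c, ψ)` with `g(a) ≠ 0`, and its regular model `X₀ ~bir V₀`
  obtain ⟨t, htc, htψ, -, hgt⟩ := hGpt c ψ hc hψ hψσ hGi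
  obtain ⟨X₀, V₀, hX₀, hV₀, hbir₀, hb₁⟩ := hR (coeffs W t) hgt
  rw [htc, htψ] at hV₀
  -- `V ≅ V₀` (same form), so `X ~bir V ≅ V₀ ~bir X₀`
  have hV' : IsHypersurfaceCutOutBy 3 (quarticForm e c ψ) V := hV
  obtain ⟨eVV₀⟩ := hV'.nonempty_iso hV₀
  have hXX₀ : AlgebraicGeometry.Scheme.BirationalOver X.hom X₀.hom :=
    (hbirX.trans (birationalOver_of_iso eVV₀)).trans hbir₀.symm
  rw [finrank_bettiCohomology_one_eq_of_birationalOver hX hX₀ hXX₀]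
  exact hb₁

end Summit.HodgeConjecture.HodgeConjecture.Theorems.Q8SymplecticPowersRegularOfGenericRegularModel

end
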